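import Literature.NumberTheory.GaloisRepresentations.HeckeCharacter
import HarnessLib

/-!
# The local conductor exponent `f(χ_v)` of an idelic Hecke character

Topic `NumberTheory/GaloisRepresentations`; companion of `HeckeCharacter.lean` (idelic Hecke
characters `χ : 𝕀_K/K^× → ℂ^×`, local components `χ_v = χ ∘ localUnits v`,
`HeckeCharacter.IsUnramifiedAt`). That file's docstring and `RohrlichAnticyclotomicNonvanishing.lean`
record the gap "the tree has no conductor ideal of an idelic Hecke character" (so the constant
`B = (2π)⁻¹(|d_K| N𝔣(χ))^{1/2}` of a functional equation is quantified existentially there). This file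
supplies the LOCAL ingredient: the higher unit groups `U_v^{(f)} = 1 + 𝔭_v^f 𝒪_v` read through the
valuation of `K_v`, the predicate "`χ_v` is trivial on `U_v^{(f)}`", the predicate "`χ` has conductor
exponent exactly `f` at `v`", and the function `conductorExponentAt` — with the convention `f = 0 ⟺
unramified`. Definitions with bodies + proved API; no named fact.

Source of the convention (verbatim, Li–Xu, J. Number Theory (2026) = arXiv:2502.12648, §2.1.1, chunk
p0006 of the held LaTeX): "We consider the decreasing filtration `𝒪_{K_v}^× ⊃ 1 + ϖ_{K_v}𝒪_{K_v} ⊃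
1 + ϖ²_{K_v}𝒪_{K_v} ⊃ ⋯ ⊃ 1 + ϖ^e_{K_v}𝒪_{K_v} ⊃ ⋯`. We say `χ_v` is unramified if `χ_v(𝒪^×_{K_v}) = 1`;
otherwise, it is called ramified. When `χ_v` is ramified, the exponent of conductor of `χ_v` is the
smallest integer `f(χ_v)` such that `χ_v(1 + ϖ^{f(χ_v)}_{K_v} 𝒪_{K_v}) = 1`. The conductor of `χ_v` is then
defined as `𝔣(χ_v) := 𝔭_v^{f(χ_v)}` […]. By convention, we set `f(χ_v) = 0` if `χ_v` is unramified."
(Equally Neukirch, *Algebraic Number Theory*, VII §6 (6.10)–(6.11) / Tate's thesis §2.3.)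

## Transcription

`v : HeightOneSpectrum (𝓞 K)` a finite place, `K_v = v.adicCompletion K` with Mathlib's `Valued.v`
(value group `ℤᵐ⁰`, uniformizers have valuation `WithZero.exp (-1)`, cf. `uniformizer` in
`HeckeCharacter.lean`), `𝒪_v = v.adicCompletionIntegers K = {x : v(x) ≤ 1}`. For `u ∈ 𝒪_v^×`,
"`u ∈ 1 + ϖ^f 𝒪_v`" ⟺ `v(u − 1) ≤ exp(−f)`; for `f = 0` this is automatic (`u − 1 ∈ 𝒪_v`), so
`U_v^{(0)} = 𝒪_v^×` and "trivial on `U_v^{(0)}`" is `IsUnramifiedAt` (proved below).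

## What is here

* `HeckeCharacter.IsTrivialOnHigherUnitsAt χ v f` — `χ_v(1 + 𝔭_v^f) = 1` (for `f = 0`: `χ_v(𝒪_v^×) = 1`).
* `HeckeCharacter.HasConductorExponentAt χ v f` — `f` is the LEAST such exponent (the printed
  `f(χ_v) = f`, with `f = 0 ⟺` unramified).
* `HeckeCharacter.conductorExponentAt χ v : ℕ` — the least exponent (`sInf`; junk `0` if `χ_v` were
  trivial on no `U^{(f)}` — excluded by continuity, not proved here).
* PROVED: `IsTrivialOnHigherUnitsAt.mono` (monotone in `f`), `isTrivialOnHigherUnitsAt_zero_iff`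
  (`f = 0` case = `IsUnramifiedAt`), `hasConductorExponentAt_zero_iff`, `HasConductorExponentAt.unique`,
  `HasConductorExponentAt.conductorExponentAt_eq`, `HasConductorExponentAt.pos_iff_not_isUnramifiedAt`.

References: [LiXu2026] §2.1.1 (arXiv:2502.12648, chunk p0006) [corpus: paper:arxiv-2502.12648 p0006];
[TateThesis1967] §2.3; Neukirch, *Algebraic Number Theory*, VII §6 (6.10)–(6.11).
-/

noncomputable section

open scoped Classical
open NumberField IsDedekindDomain

namespace Literature.NumberTheory.GaloisRepresentations.HeckeCharacter

universe u

variable {K : Type u} [Field K] [NumberField K] (χ : HeckeCharacter K) (v : HeightOneSpectrum (𝓞 K))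

/-- **`χ_v` is trivial on the higher unit group `U_v^{(f)} = 1 + 𝔭_v^f 𝒪_v`**: for every unit `u` of
`𝒪_v` with `v(u − 1) ≤ ϖ^f` (i.e. `u ≡ 1 (mod 𝔭_v^f)`; automatic when `f = 0`), `χ_v(u) = 1`. Li–Xu
§2.1.1: "the smallest integer `f(χ_v)` such that `χ_v(1 + ϖ^{f(χ_v)}_{K_v} 𝒪_{K_v}) = 1`" — this is the
predicate "`χ_v(1 + ϖ^f 𝒪) = 1`" for a given `f`. [cite: LiXu2026, §2.1.1 (arXiv:2502.12648)]
[cite: TateThesis1967, §2.3] -/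
def IsTrivialOnHigherUnitsAt (f : ℕ) : Prop :=
  ∀ u : (v.adicCompletionIntegers K)ˣ,
    Valued.v ((((u : v.adicCompletionIntegers K)) : v.adicCompletion K) - 1) ≤ WithZero.exp (-(f : ℤ)) →
      χ.localComponent v (Units.map ((v.adicCompletionIntegers K).subtype : _ →* _) u) = 1

/-- **`χ` has conductor exponent exactly `f` at `v`** (`f(χ_v) = f`): `χ_v` is trivial on `U_v^{(f)}`
and on no `U_v^{(g)}` with `g < f` (so `f = 0` iff `χ` is unramified at `v`,
`hasConductorExponentAt_zero_iff`). Li–Xu §2.1.1: "the exponent of conductor of `χ_v` is the smallest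
integer `f(χ_v)` such that `χ_v(1 + ϖ^{f(χ_v)} 𝒪_{K_v}) = 1` […] By convention, we set `f(χ_v) = 0` if
`χ_v` is unramified." [cite: LiXu2026, §2.1.1 (arXiv:2502.12648)] [cite: TateThesis1967, §2.3] -/
def HasConductorExponentAt (f : ℕ) : Prop :=
  χ.IsTrivialOnHigherUnitsAt v f ∧ ∀ g : ℕ, g < f → ¬ χ.IsTrivialOnHigherUnitsAt v g

/-- **The conductor exponent `f(χ_v) ∈ ℕ`**: the least `f` with `χ_v(U_v^{(f)}) = 1` (Li–Xu §2.1.1;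
Neukirch VII (6.10)); junk value `0` if there is no such `f` (there always is one, by continuity of
`χ` and openness of the `U_v^{(f)}` — not proved here). The conductor ideal of `χ_v` is then
`𝔭_v^{f(χ_v)}`. [cite: LiXu2026, §2.1.1 (arXiv:2502.12648)] [cite: TateThesis1967, §2.3] -/
def conductorExponentAt : ℕ :=
  sInf {f : ℕ | χ.IsTrivialOnHigherUnitsAt v f}

variable {χ v}

/-- The filtration is decreasing, so triviality on `U^{(f)}` implies triviality on `U^{(g)}` for
`g ≥ f`. [cite: LiXu2026, §2.1.1 (the decreasing filtration) (arXiv:2502.12648)] -/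
theorem IsTrivialOnHigherUnitsAt.mono {f g : ℕ} (hfg : f ≤ g) (h : χ.IsTrivialOnHigherUnitsAt v f) :
    χ.IsTrivialOnHigherUnitsAt v g := by
  intro u hu
  refine h u (le_trans hu ?_)
  exact WithZero.exp_le_exp.mpr (by omega)

/-- `U_v^{(0)} = 𝒪_v^×`: triviality on `U^{(0)}` is exactly `IsUnramifiedAt` ("We say `χ_v` is
unramified if `χ_v(𝒪^×_{K_v}) = 1`"; a unit `u` of `𝒪_v` has `v(u − 1) ≤ 1 = exp 0`).
[cite: LiXu2026, §2.1.1 (arXiv:2502.12648)] [cite: TateThesis1967, §2.3] -/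
theorem isTrivialOnHigherUnitsAt_zero_iff :
    χ.IsTrivialOnHigherUnitsAt v 0 ↔ χ.IsUnramifiedAt v := by
  constructor
  · intro h u
    refine h u ?_
    -- `u - 1 ∈ 𝒪_v`, i.e. `v(u - 1) ≤ 1 = exp 0`
    have h2 : ((((u : v.adicCompletionIntegers K) - 1 : v.adicCompletionIntegers K)) :
        v.adicCompletion K) ∈ v.adicCompletionIntegers K :=
      ((u : v.adicCompletionIntegers K) - 1).2
    rw [HeightOneSpectrum.mem_adicCompletionIntegers] at h2
    have h3 : ((((u : v.adicCompletionIntegers K) - 1 : v.adicCompletionIntegers K)) :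
        v.adicCompletion K) = ((u : v.adicCompletionIntegers K) : v.adicCompletion K) - 1 := rfl
    rw [h3] at h2
    simpa using h2
  · intro h u _
    exact h u

/-- `f(χ_v) = 0` iff `χ` is unramified at `v` ("By convention, we set `f(χ_v) = 0` if `χ_v` is
unramified"). [cite: LiXu2026, §2.1.1 (arXiv:2502.12648)] -/
theorem hasConductorExponentAt_zero_iff :
    χ.HasConductorExponentAt v 0 ↔ χ.IsUnramifiedAt v := by
  simp only [HasConductorExponentAt, Nat.not_lt_zero, IsEmpty.forall_iff, implies_true, and_true]
  exact isTrivialOnHigherUnitsAt_zero_iff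

/-- The conductor exponent is unique. [cite: LiXu2026, §2.1.1 (arXiv:2502.12648)] -/
theorem HasConductorExponentAt.unique {f g : ℕ} (hf : χ.HasConductorExponentAt v f)
    (hg : χ.HasConductorExponentAt v g) : f = g := by
  rcases lt_trichotomy f g with h | h | h
  · exact absurd hf.1 (hg.2 f h)
  · exact h
  · exact absurd hg.1 (hf.2 g h)

/-- If `χ` has conductor exponent `f` at `v` then `conductorExponentAt χ v = f`.
[cite: LiXu2026, §2.1.1 (arXiv:2502.12648)] -/
theorem HasConductorExponentAt.conductorExponentAt_eq {f : ℕ} (hf : χ.HasConductorExponentAt v f) :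
    χ.conductorExponentAt v = f := by
  unfold conductorExponentAt
  apply le_antisymm
  · exact Nat.sInf_le hf.1
  · by_contra hlt
    have hlt : sInf {g : ℕ | χ.IsTrivialOnHigherUnitsAt v g} < f := Nat.lt_of_not_le hlt
    have hne : {g : ℕ | χ.IsTrivialOnHigherUnitsAt v g}.Nonempty := ⟨f, hf.1⟩
    exact hf.2 _ hlt (Nat.sInf_mem hne)

/-- A positive conductor exponent means `χ` is ramified at `v` ("When `χ_v` is ramified, the exponent
of conductor … "; conversely `f = 0` is the unramified convention).
[cite: LiXu2026, §2.1.1 (arXiv:2502.12648)] -/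
theorem HasConductorExponentAt.pos_iff_not_isUnramifiedAt {f : ℕ} (hf : χ.HasConductorExponentAt v f) :
    0 < f ↔ ¬ χ.IsUnramifiedAt v := by
  constructor
  · intro hpos hun
    exact hf.2 0 hpos (isTrivialOnHigherUnitsAt_zero_iff.mpr hun)
  · intro hram
    by_contra h0
    have hf0 : f = 0 := by omega
    subst hf0
    exact hram (hasConductorExponentAt_zero_iff.mp hf)

end Literature.NumberTheory.GaloisRepresentations.HeckeCharacter
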